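/-
Copyright: lit-balaban cell, Phase-2 proof seat p33 (gen 7).  Statement-level skeleton of a published paper; no proof claims beyond
what the kernel checks below.
-/
import Literature.MathematicalPhysics.QuantumFieldTheory.BalabanImbrieJaffe1984to88.BIJ85Claim73Residual
import Literature.MathematicalPhysics.QuantumFieldTheory.TorusChartCurlPrimitive

/-!
# `BalabanImbrieJaffe1984to88.BIJ85Claim73Closed` — T. Bałaban, J. Imbrie, A. Jaffe, *Renormalization of the Higgs model:
minimizers, propagators and the stability of mean field theory*, Commun. Math. Phys. **97** (1985) 299–329
[BalabanImbrieJaffe1985]: **(7.3.1) ⇒ (7.3.2) for the ACTUAL background (4.5.4), with the located input restricted to CLOSED plaquette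
fields** — the form in which it is uniform in `k`.  The plaquette field `f^{(k)} = (ie_k)^{−1} ln v(∂p)` of (4.2.4) is CLOSED (lattice Bianchi
identity `df^{(k)} = 0` on every unit cube) as soon as (7.3.1) holds with `e_k𝓅(e_k) ≤ ½` (p. 326: *"f^{(k)} can locally be represented as a
curl"*), so the sup-norm property of the residual operator `R_k = (I − ∂G_{k,Ax}∂^*)Q^{e*}_k` of (4.2.6) is only NEEDED on closed fields —
where it is the regularity of the minimizers (file D `BIJ85ResidualMinimizer`: on exact fields `f_k(∂B) = ∂H_kB`), whereas on non-closed
sources (single plaquettes) `R_k` carries the field of the magnetic charges at the ends of the flux tubes `Q^{e*}_kδ_{p′}`, of size `∼ L^{2k}`,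
so file B's all-field property `ResIdx.hR` holds at each `k` (file C: `K₁(d, L)` at `k = 1`) but not uniformly in `k` (seat reading note,
HOME/GAPS.md G-C1-05).  File E of this seat's gen-7 member of SKELETON row **C1.Eq7.3.1-7.3.2** (owner r15, referee ref-5; files A–D
`BIJ85Eq454PlaqResidual`, `BIJ85Claim73Residual`, `BIJ85Claim73ActualOne`, `BIJ85ResidualMinimizer`).

statement-level skeleton of published theorems with citation tags; proofs where landed; nothing here is a claim about the Yang–Mills mass gap

PDF held: `paper:balaban1985-cmp97-bij-higgs-minimizers` (journal page = PDF page + 298).  Pages read this session (`lit read`, OCR text):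
p. 311 [PDF 13], p. 317 [PDF 19], p. 326 [PDF 28] (*"This is a local procedure since f^{(k)} can locally be represented as a curl."*).

CITATION HEADER (lean-in-tree rule).  Phase-2 file of the lit-balaban TYPED SKELETON (HOME `run/shared/lean/pub/lit-balaban/`), seat p33 gen 7
(unit `lit-balaban-p33-g7`).  Objects BY NAME: r15's `BIJ85Sect1Model.plaq`/`U1Field`, `BIJ85SmallFieldSplit64.plaqField`/`expField`/
`curl1`/`plaq_expField`, p31's `circleExp_plaqField`/`curl_one_eq_curl1`, p30's `expField_bondPotential`, p11's `runSite_shift_comm`,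
`ineq732_general_phys`, `sq_hyp731_le`, file A's `resE`/`actualBgU1`/`norm_plaqC_actualBgU1_sub_one_le`, file B's `abs_plaqField_le_of_dev`,
gen 6's `abs_arg_le_of_norm_eq_one`.  Definitions with bodies: `dPlaq` (the lattice exterior derivative of a plaquette field on a unit cube),
the index `ClosedIdx`, `closedG`, `closedStabData`.  No `def … : Prop`, no named fact (D-0026).

THE PRINTED TEXT, verbatim (p. 326 [PDF 28]): *"let us assume that for the unit lattice field v, |v(∂p) − 1| ≤ e_k𝓅(e_k), (7.3.1) … For
constants γ > 0, α > 0, M < ∞, ⟨φ, Δ_k(u_k)φ⟩ ≥ γ Σ_{b∈T₁^{(k)}} |u_k(b)φ(b₊) − φ(b₋)|² − Me_k^{2−α} Σ_{x∈T₁^{(k)}} |φ(x)|². (7.3.2) … This is a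
local procedure since f^{(k)} can locally be represented as a curl."*

WHAT IS PROVED (0 `sorry`, standard axioms).
* §1 `dPlaq g x (μ<ν<λ)` = `(dg)_{μνλ}(x)`; `dPlaq_curl` (`d∂ = 0`); **`plaq_bianchi`** (the `U(1)` Bianchi identity on the tori: the oriented product
  of the six plaquette variables of a unit cube is `1`); **`dPlaq_plaqField_eq_zero`** (`f^{(k)}` is closed whenever all `|v(∂p) − 1| ≤ t ≤ ½`:
  the six angles are `≤ π/4 < 2π/6`); §1b (v1.1) the BRIDGE to the torus cochain calculus of `TorusChart*.lean` used by the
  discrete Hodge decomposition (p30 `TorusChartCurlPrimitiveGrowth.exists_const₂_add_d₁_of_closed`): `dPlaq_eq_d₂` (`dPlaq` IS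
  `TorusChart.d₂` of any `2`-cochain extending `g`, read in the isotropic chart `B5Positivity172Lattice.chart` of `T^{(k)}`), the alternating
  extension `altExt g` (`altExt_apply`, `isAlt₂_altExt`) and **`d₂_altExt_eq_zero_iff`** (`d₂ (altExt g) = 0 ↔ dg = 0` on every cube).
* §2 `ClosedIdx d K_R 𝓅` (torus of dimension `d ≥ 2`, `1 ≤ k ≤ m + K`, `0 < e_k ≤ 1` with `e_k𝓅(e_k) ≤ ½`, ANY `v`; field `hR` = the residual
  property ON CLOSED FIELDS at constant `K_R`), `closedG`, `closedStabData` (PRINTED `plaqDev`, first printed form, THE inverse (4.6.2) at `u_k`),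
  **`ineq732_closedStabData`**, **`claim73_closed`** — `Claim73 𝓅` with `γ = min(a/(9(d+1)), 1/12)`, `α = ½`, `M = (4/3)d⁴((π/2)K_R)²(1+4𝓅₊)^{2𝓅₊}`;
  `ResIdx.toClosedIdx` (file B's all-field index implies this one); `ClosedIdx.ofD₂` (v1.1: the index built from a residual bound stated
  with `TorusChart.d₂`-closedness, the form in which Sect. 7.2 supplies it).
HONEST SCOPE.  As in file B; the regime `e_k𝓅(e_k) ≤ ½` is the small-field standing assumption under which the branch (2.11) makes `f^{(k)}`
closed; the discharge of `hR` for general `k` (regularity of `∂H_k`, Sect. 7.2, plus the harmonic part of a closed field on the torus) is NOT done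
here.
-/

open scoped RealInnerProductSpace BigOperators
open Finset

namespace Literature.MathematicalPhysics.QuantumFieldTheory.BalabanImbrieJaffe1984to88.BIJ85Claim73Closed

open Literature.MathematicalPhysics.QuantumFieldTheory.Balaban1983to89
open LatticeFieldCalculus (curl)
open BIJ88Sect3Statements (U1 toC)
open BIJ85Sect1Model (U1Field plaq bondPotential)
open BIJ85SmallFieldSplit64 (plaqField expField curl1 plaq_expField)
open BIJ85Eq454Holonomy (circleExp_plaqField curl_one_eq_curl1)
open BIJ85Rem317AnyField (expField_bondPotential)
open BIJ85BlockAveragesTorus (runSite runSite_zero runSite_shift)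
open BIJ85BlockAveragesTorusK BIJ85ScalarPropagatorTorus BIJ85ScalarPropagatorTorusK
open BIJ85ScalarForm464 BIJ85BlockAveragingIneq BIJ85Ineq732Flat BIJ85Ineq732General
open BIJ85AbelianStokes (plaqC runSite_shift_comm)
open BIJ85Sigma421Torus (toU)
open BIJ85Sigma422Eta (eta_pos)
open BIJ85Eq454PlaqResidual BIJ85Claim73Residual
open B5Positivity172Lattice (TT chart toT ofT shift_eq)

noncomputable section

variable {P : Params} {j : ℕ}

/-! ## §1 The lattice exterior derivative of a plaquette field; the Bianchi identity; closedness of `f^{(k)}` -/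

/-- plumbing: translations of the torus commute (from p11's `runSite_shift_comm`). [folklore] -/
private theorem shift_comm' (x : Balaban1983to89.Site P j) (μ ν : Fin P.d) : (x.shift μ).shift ν = (x.shift ν).shift μ := by
  have h1 : ∀ (y : Balaban1983to89.Site P j) (κ : Fin P.d), y.shift κ = runSite y κ 1 := fun y κ => by
    rw [← runSite_shift, runSite_zero]
  rw [h1 x μ, h1 (x.shift ν) μ, runSite_shift_comm]

/-- The lattice exterior derivative of a unit-lattice plaquette field on the cube `⟨x; μ < ν < λ⟩`:
`(dg)_{μνλ}(x) = [g_{νλ}(x+e_μ) − g_{νλ}(x)] − [g_{μλ}(x+e_ν) − g_{μλ}(x)] + [g_{μν}(x+e_λ) − g_{μν}(x)]` — `g` is CLOSED when this vanishes on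
every cube (p. 326: *"f^{(k)} can locally be represented as a curl"*). [cite: BalabanImbrieJaffe1985, p.326 (text)] -/
def dPlaq (g : Balaban1983to89.Plaq P j → ℝ) (x : Balaban1983to89.Site P j) {μ ν lam : Fin P.d} (hμν : μ < ν) (hνl : ν < lam) : ℝ :=
  (g ⟨x.shift μ, ν, lam, hνl⟩ - g ⟨x, ν, lam, hνl⟩) - (g ⟨x.shift ν, μ, lam, hμν.trans hνl⟩ - g ⟨x, μ, lam, hμν.trans hνl⟩)
    + (g ⟨x.shift lam, μ, ν, hμν⟩ - g ⟨x, μ, ν, hμν⟩)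

/-- kernel: **`d∂ = 0`** — the curl of a bond field is closed (each bond of the cube enters twice with opposite signs).
[cite: BalabanImbrieJaffe1985, p.326 (text)] -/
theorem dPlaq_curl (c : ℝ) (B : PBond P j → ℝ) (x : Balaban1983to89.Site P j) {μ ν lam : Fin P.d} (hμν : μ < ν) (hνl : ν < lam) :
    dPlaq (curl c B) x hμν hνl = 0 := by
  simp only [dPlaq, curl, smul_eq_mul]
  rw [shift_comm' x ν μ, shift_comm' x lam μ, shift_comm' x lam ν]
  ring

/-- **THE `U(1)` BIANCHI IDENTITY ON THE TORI**: for every `U(1)` field `u` and every unit cube `⟨x; μ < ν < λ⟩`, the oriented product of the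
six plaquette variables is `1`: `u(∂p_{νλ}(x+e_μ))/u(∂p_{νλ}(x)) / [u(∂p_{μλ}(x+e_ν))/u(∂p_{μλ}(x))] · [u(∂p_{μν}(x+e_λ))/u(∂p_{μν}(x))] = 1` (abelian:
`u = exp(iB)` bondwise by (4.5.1), `u(∂p) = exp(i(∂B)(p))` and `d∂ = 0`). [cite: BalabanImbrieJaffe1985, p.326 (text)] -/
theorem plaq_bianchi (u : U1Field P j) (x : Balaban1983to89.Site P j) {μ ν lam : Fin P.d} (hμν : μ < ν) (hνl : ν < lam) :
    plaq u ⟨x.shift μ, ν, lam, hνl⟩ / plaq u ⟨x, ν, lam, hνl⟩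
        / (plaq u ⟨x.shift ν, μ, lam, hμν.trans hνl⟩ / plaq u ⟨x, μ, lam, hμν.trans hνl⟩)
        * (plaq u ⟨x.shift lam, μ, ν, hμν⟩ / plaq u ⟨x, μ, ν, hμν⟩) = 1 := by
  set B : PBond P j → ℝ := bondPotential 1 u with hB
  have hu : u = expField 1 B := (expField_bondPotential 1 one_ne_zero u).symm
  have key : ∀ p : Balaban1983to89.Plaq P j, plaq u p = Circle.exp (curl 1 B p) := by
    intro p
    rw [hu, plaq_expField, one_mul, curl_one_eq_curl1]
  simp only [key, ← Circle.exp_sub, ← Circle.exp_add]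
  rw [show curl 1 B ⟨x.shift μ, ν, lam, hνl⟩ - curl 1 B ⟨x, ν, lam, hνl⟩
      - (curl 1 B ⟨x.shift ν, μ, lam, hμν.trans hνl⟩ - curl 1 B ⟨x, μ, lam, hμν.trans hνl⟩)
      + (curl 1 B ⟨x.shift lam, μ, ν, hμν⟩ - curl 1 B ⟨x, μ, ν, hμν⟩) = dPlaq (curl 1 B) x hμν hνl from rfl,
    dPlaq_curl, Circle.exp_zero]

/-- **`f^{(k)}` IS CLOSED IN THE SMALL-FIELD REGION**: if `|v(∂p) − 1| ≤ t` for every plaquette with `t ≤ ½` and `e > 0`, then the plaquette field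
`f = (ie)^{−1} ln v(∂·)` ((4.2.4), branch (2.11)) satisfies `df = 0` on every unit cube — the six angles `e·f(p)` are at most `(π/2)t ≤ π/4` in
modulus, their signed sum is a multiple of `2π` by the Bianchi identity, hence `0` (p. 326: *"f^{(k)} can locally be represented as a curl"*).
[cite: BalabanImbrieJaffe1985, p.326 (text)] -/
theorem dPlaq_plaqField_eq_zero {e : ℝ} (he : 0 < e) (v : U1Field P j) {t : ℝ} (ht : t ≤ 1 / 2)
    (hv : ∀ p : Balaban1983to89.Plaq P j, ‖((plaq v p : Circle) : ℂ) - 1‖ ≤ t) (x : Balaban1983to89.Site P j) {μ ν lam : Fin P.d}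
    (hμν : μ < ν) (hνl : ν < lam) :
    dPlaq (plaqField e v) x hμν hνl = 0 := by
  set f := plaqField e v with hf
  -- each angle e·f(p) is at most π/4 in modulus
  have hang : ∀ p : Balaban1983to89.Plaq P j, |e * f p| ≤ Real.pi / 4 := by
    intro p
    have h1 := abs_plaqField_le_of_dev he v p
    rw [abs_mul, abs_of_pos he]
    have h2 : |f p| ≤ Real.pi / 2 * t / e := by
      refine h1.trans ?_
      gcongr
      exact hv p
    calc e * |f p| ≤ e * (Real.pi / 2 * t / e) := mul_le_mul_of_nonneg_left h2 he.le
      _ = Real.pi / 2 * t := by field_simp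
      _ ≤ Real.pi / 2 * (1 / 2) := by gcongr
      _ = Real.pi / 4 := by ring
  -- the Bianchi identity exponentiated: exp(i·e·df) = 1
  have hexp : Circle.exp (e * dPlaq f x hμν hνl) = 1 := by
    have key : ∀ p : Balaban1983to89.Plaq P j, Circle.exp (e * f p) = plaq v p := fun p => circleExp_plaqField e he.ne' v p
    have e1 : e * dPlaq f x hμν hνl = e * f ⟨x.shift μ, ν, lam, hνl⟩ - e * f ⟨x, ν, lam, hνl⟩
        - (e * f ⟨x.shift ν, μ, lam, hμν.trans hνl⟩ - e * f ⟨x, μ, lam, hμν.trans hνl⟩)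
        + (e * f ⟨x.shift lam, μ, ν, hμν⟩ - e * f ⟨x, μ, ν, hμν⟩) := by
      simp only [dPlaq]; ring
    rw [e1]
    simp only [Circle.exp_add, Circle.exp_sub, key]
    exact plaq_bianchi v x hμν hνl
  -- hence e·df ∈ 2πℤ with |e·df| ≤ 6π/4 < 2π
  obtain ⟨n, hn⟩ := Circle.exp_eq_one.1 hexp
  have hbound : |e * dPlaq f x hμν hνl| ≤ 6 * (Real.pi / 4) := by
    have e1 : e * dPlaq f x hμν hνl = e * f ⟨x.shift μ, ν, lam, hνl⟩ - e * f ⟨x, ν, lam, hνl⟩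
        - (e * f ⟨x.shift ν, μ, lam, hμν.trans hνl⟩ - e * f ⟨x, μ, lam, hμν.trans hνl⟩)
        + (e * f ⟨x.shift lam, μ, ν, hμν⟩ - e * f ⟨x, μ, ν, hμν⟩) := by
      simp only [dPlaq]; ring
    rw [e1]
    have h1 := hang ⟨x.shift μ, ν, lam, hνl⟩; have h2 := hang ⟨x, ν, lam, hνl⟩
    have h3 := hang ⟨x.shift ν, μ, lam, hμν.trans hνl⟩; have h4 := hang ⟨x, μ, lam, hμν.trans hνl⟩
    have h5 := hang ⟨x.shift lam, μ, ν, hμν⟩; have h6 := hang ⟨x, μ, ν, hμν⟩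
    rw [abs_le] at h1 h2 h3 h4 h5 h6 ⊢
    constructor <;> linarith [h1.1, h1.2, h2.1, h2.2, h3.1, h3.2, h4.1, h4.2, h5.1, h5.2, h6.1, h6.2]
  have hn0 : n = 0 := by
    have hπ := Real.pi_pos
    rw [hn, abs_mul, abs_of_pos (by positivity : (0 : ℝ) < 2 * Real.pi)] at hbound
    have h1 : |(n : ℝ)| < 1 := by nlinarith
    have h2 : |n| < 1 := by exact_mod_cast h1
    exact Int.abs_lt_one_iff.mp h2
  rw [hn0, Int.cast_zero, zero_mul] at hn
  exact (mul_eq_zero.1 hn).resolve_left he.ne'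

/-! ## §1b (v1.1) Bridge to the torus cochain calculus: `dPlaq` is `TorusChart.d₂` -/

/-- **`dg` IS THE DEGREE-TWO COBOUNDARY `d₂` of the torus cochain calculus**: for ANY `2`-cochain `ω` on `T^{(j)} = (ℤ/N)^d` (isotropic
chart) extending `g` on increasing pairs, `(d₂ω)(x; μ, ν, λ) = (dg)_{μνλ}(x)` for `μ < ν < λ` (only increasing pairs enter `d₂` at a sorted
triple). [cite: BalabanImbrieJaffe1985, p.326 (text)] -/
theorem dPlaq_eq_d₂ (g : Balaban1983to89.Plaq P j → ℝ) (ω : TT P j → Fin P.d → Fin P.d → ℝ)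
    (hω : ∀ (y : Balaban1983to89.Site P j) (α β : Fin P.d) (h : α < β), ω (toT y) α β = g ⟨y, α, β, h⟩)
    (x : Balaban1983to89.Site P j) {μ ν lam : Fin P.d} (hμν : μ < ν) (hνl : ν < lam) :
    (chart P j).d₂ ω (toT x) μ ν lam = dPlaq g x hμν hνl := by
  simp only [TorusChart.d₂_apply, dPlaq, shift_eq, ← hω]

/-- the ALTERNATING `2`-cochain of a plaquette field: `g_{αβ}(y) = g(p_{αβ}(y))` for `α < β`, `−g(p_{βα}(y))` for `β < α`, `0` on the
diagonal (the usual identification of plaquette functions with antisymmetric tensor fields, (4.2.4)). [cite: BalabanImbrieJaffe1985, (4.2.4) p.311] -/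
def altExt (g : Balaban1983to89.Plaq P j → ℝ) : TT P j → Fin P.d → Fin P.d → ℝ := fun y α β =>
  if h : α < β then g ⟨ofT y, α, β, h⟩ else if h' : β < α then -g ⟨ofT y, β, α, h'⟩ else 0

/-- kernel: `altExt g` extends `g` on increasing pairs. [cite: BalabanImbrieJaffe1985, (4.2.4) p.311] -/
theorem altExt_apply (g : Balaban1983to89.Plaq P j → ℝ) (y : Balaban1983to89.Site P j) (α β : Fin P.d) (h : α < β) :
    altExt g (toT y) α β = g ⟨y, α, β, h⟩ := by
  simp [altExt, h]

/-- kernel: `altExt g` is alternating. [cite: BalabanImbrieJaffe1985, (4.2.4) p.311] -/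
theorem isAlt₂_altExt (g : Balaban1983to89.Plaq P j → ℝ) : TorusChart.IsAlt₂ (altExt g) := by
  refine ⟨fun y i => by simp [altExt], fun y i i' => ?_⟩
  unfold altExt
  rcases lt_trichotomy i i' with h | rfl | h
  · simp [h, not_lt.2 h.le]
  · simp
  · simp [h, not_lt.2 h.le]

/-- **CLOSEDNESS, BOTH READINGS AGREE**: `d₂ (altExt g) = 0` on the charted torus `T^{(j)}` iff `(dg)_{μνλ}(x) = 0` on every unit cube
(`d₂` of an alternating cochain vanishes at repeated indices and is `±` its value at the sorted triple). [cite: BalabanImbrieJaffe1985, p.326 (text)] -/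
theorem d₂_altExt_eq_zero_iff (g : Balaban1983to89.Plaq P j → ℝ) :
    (chart P j).d₂ (altExt g) = 0 ↔
      ∀ (x : Balaban1983to89.Site P j) (μ ν lam : Fin P.d) (hμν : μ < ν) (hνl : ν < lam), dPlaq g x hμν hνl = 0 := by
  have hω := altExt_apply (P := P) (j := j) g
  constructor
  · intro h x μ ν lam hμν hνl
    rw [← dPlaq_eq_d₂ g (altExt g) hω x hμν hνl, h]; rfl
  · intro h
    funext y i i' k
    have S : ∀ a b c : Fin P.d, a < b → b < c → (chart P j).d₂ (altExt g) y a b c = 0 := fun a b c hab hbc => by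
      rw [show y = toT (ofT y) from rfl, dPlaq_eq_d₂ g (altExt g) hω (ofT y) hab hbc]; exact h _ _ _ _ hab hbc
    have D : ∀ a b c : Fin P.d, (chart P j).d₂ (altExt g) y a b c
        = (altExt g (y + (chart P j).gen a) b c - altExt g y b c) - (altExt g (y + (chart P j).gen b) a c - altExt g y a c)
          + (altExt g (y + (chart P j).gen c) a b - altExt g y a b) := fun a b c => rfl
    simp only [Pi.zero_apply]
    have sw := (isAlt₂_altExt g).swap; have dg := (isAlt₂_altExt g).diag
    rcases lt_trichotomy i i' with hij | rfl | hji
    · rcases lt_trichotomy i' k with hjk | rfl | hkj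
      · exact S i i' k hij hjk
      · rw [D]; simp [dg]
      · rcases lt_trichotomy i k with hik | rfl | hki
        · have := S i k i' hik hkj; rw [D] at this ⊢
          linarith [sw (y + (chart P j).gen i) i' k, sw y i' k]
        · rw [D]; simp [dg, sw _ i i']
        · have := S k i i' hki hij; rw [D] at this ⊢
          linarith [sw (y + (chart P j).gen i) i' k, sw y i' k, sw (y + (chart P j).gen i') i k, sw y i k]
    · rw [D]; simp [dg]
    · rcases lt_trichotomy i k with hik | rfl | hki
      · have := S i' i k hji hik; rw [D] at this ⊢
        linarith [sw (y + (chart P j).gen k) i i', sw y i i']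
      · rw [D]; simp [dg, sw _ i' i]
      · rcases lt_trichotomy i' k with hjk | rfl | hkj
        · have := S i' k i hjk hki; rw [D] at this ⊢
          linarith [sw (y + (chart P j).gen i') i k, sw y i k, sw (y + (chart P j).gen k) i i', sw y i i']
        · rw [D]; simp [dg]
        · have := S k i' i hkj hji; rw [D] at this ⊢
          linarith [sw (y + (chart P j).gen i) i' k, sw y i' k, sw (y + (chart P j).gen i') i k, sw y i k,
            sw (y + (chart P j).gen k) i i', sw y i i']

/-! ## §2 The actual family with the located input on CLOSED fields -/

/-- Index of the family of ACTUAL Sect. 7.3 data at residual constant `K_R` and exponent `𝓅`, CLOSED-FIELD FORM: a torus `P` of dimension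
`d ≥ 2`, `1 ≤ k ≤ m + K`, the coupling `0 < e_k ≤ 1` in the small-field regime `e_k𝓅(e_k) ≤ ½` (so that `f^{(k)}` is closed, §1), ANY unit-lattice
`U(1)` field `v`, and the located input: the sup-norm property of the residual operator `(I − ∂G_{k,Ax}∂^*)Q^{e*}_k` ON CLOSED plaquette fields
(`dg = 0` on every cube) at constant `K_R` — the regularity of the minimizers, Sect. 7.2 (file D). [cite: BalabanImbrieJaffe1985, (7.3.1) p.326] -/
structure ClosedIdx (d : ℕ) (KR pexp : ℝ) where
  P : Params
  hd : P.d = d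
  hd2 : 2 ≤ P.d
  k : ℕ
  hk1 : 1 ≤ k
  hk : k ≤ P.m + P.K
  e : ℝ
  he : 0 < e
  he1 : e ≤ 1
  hsmall : e * (1 + Real.log e⁻¹) ^ pexp ≤ 1 / 2
  v : U1Field P k
  hR : ∀ (g : Balaban1983to89.Plaq P k → ℝ),
    (∀ (x : Balaban1983to89.Site P k) (μ ν lam : Fin P.d) (hμν : μ < ν) (hνl : ν < lam), dPlaq g x hμν hνl = 0) →
    ∀ (C : ℝ), (∀ q, |g q| ≤ C) →
      ∀ p : Balaban1983to89.Plaq P 0, |resE hd2 ((P.eta k) ^ P.d) (P.eta k)⁻¹ k (toU P k g) p| ≤ KR * Real.sqrt ((P.eta k) ^ P.d) * C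

namespace ClosedIdx

variable {d : ℕ} {KR pexp : ℝ}

/-- kernel: `0 + k ≤ m + K`. [cite: BalabanImbrieJaffe1985, (4.5.4) p.313] -/
theorem hk0 (i : ClosedIdx d KR pexp) : 0 + i.k ≤ i.P.m + i.P.K := by have := i.hk; omega

/-- kernel: the printed `a_k > 0`. [cite: BalabanImbrieJaffe1985, (4.6.4) p.313] -/
theorem aK_pos (i : ClosedIdx d KR pexp) {a : ℝ} (ha : 0 < a) : 0 < BIJ85Sect4Statements.aK a i.P.L i.k :=
  (BIJ85CoefficientAk464.aK_pos_le ha (by linarith [three_le_L i.P]) i.hk1).1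

/-- the actual background (4.5.4) of the index (file A's `actualBgU1`). [cite: BalabanImbrieJaffe1985, (4.5.4) p.313] -/
def U (i : ClosedIdx d KR pexp) : GaugeField i.P 0 U1 := actualBgU1 i.hd2 i.k i.e i.v

/-- kernel: `K_R ≥ 0` (the property at the closed field `g = 0`, `C = 1`). [cite: BalabanImbrieJaffe1985, (4.2.6) p.311] -/
theorem KR_nonneg (i : ClosedIdx d KR pexp) : 0 ≤ KR := by
  have h := i.hR (fun _ => 0) (fun _ _ _ _ _ _ => by simp [dPlaq]) 1 (fun _ => by simp)
    ⟨default, ⟨0, by have := i.hd2; omega⟩, ⟨1, by have := i.hd2; omega⟩, by simp [Fin.lt_def]⟩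
  have h0 : toU i.P i.k (fun _ => (0 : ℝ)) = 0 := by ext q; rfl
  rw [h0, resE, map_zero, map_zero, sub_zero, mul_one] at h
  have h1 : (0 : ℝ) ≤ KR * Real.sqrt ((i.P.eta i.k) ^ i.P.d) := by simpa using h
  exact nonneg_of_mul_nonneg_left (by rwa [mul_comm] at h1) (Real.sqrt_pos.2 (pow_pos (eta_pos i.P i.k) _))

/-- **the index built from a residual bound stated with `TorusChart.d₂`-closedness** — the form in which Sect. 7.2 (discrete Hodge on
`T^{(k)}` + regularity of `∂H_k` + the constant part) supplies the located input: `∀ F, d₂ (altExt F) = 0 → |F| ≤ s → |f_k(F)(p)| ≤ √w·K_R·s`.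
[cite: BalabanImbrieJaffe1985, (7.3.1) p.326] -/
def ofD₂ (P : Params) (hd : P.d = d) (hd2 : 2 ≤ P.d) (k : ℕ) (hk1 : 1 ≤ k) (hk : k ≤ P.m + P.K) (e : ℝ) (he : 0 < e)
    (he1 : e ≤ 1) (hsmall : e * (1 + Real.log e⁻¹) ^ pexp ≤ 1 / 2) (v : U1Field P k)
    (hbound : ∀ F : Balaban1983to89.Plaq P k → ℝ, (chart P k).d₂ (altExt F) = 0 → ∀ s : ℝ, (∀ q, |F q| ≤ s) →
      ∀ p : Balaban1983to89.Plaq P 0, |resE hd2 ((P.eta k) ^ P.d) (P.eta k)⁻¹ k (toU P k F) p| ≤ Real.sqrt ((P.eta k) ^ P.d) * KR * s) :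
    ClosedIdx d KR pexp where
  P := P
  hd := hd
  hd2 := hd2
  k := k
  hk1 := hk1
  hk := hk
  e := e
  he := he
  he1 := he1
  hsmall := hsmall
  v := v
  hR := fun g hg C hC p => by
    rw [mul_comm KR]
    exact hbound g ((d₂_altExt_eq_zero_iff g).2 hg) C hC p

end ClosedIdx

/-- `G_k(u_k)`: THE inverse (4.6.2) at the actual background of the index (p11's `exists_GK`, `Classical.choose`).
[cite: BalabanImbrieJaffe1985, (4.6.2) p.313] -/
def closedG {d : ℕ} {KR pexp : ℝ} (a : ℝ) (ha : 0 < a) (i : ClosedIdx d KR pexp) : FineSp i.P 0 →ₗ[ℝ] FineSp i.P 0 :=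
  Classical.choose (exists_GK i.hk0 (cPhys_pos i.P i.k).ne' (i.aK_pos ha) i.U)

/-- kernel: `closedG` is a right inverse of `D_u^*D_u + a_kQ_k(u)^*Q_k(u)` at `u = u_k`. [cite: BalabanImbrieJaffe1985, (4.6.2) p.313] -/
theorem closedG_spec {d : ℕ} {KR pexp : ℝ} (a : ℝ) (ha : 0 < a) (i : ClosedIdx d KR pexp) (φ : FineSp i.P 0) :
    opT (Dlin (cPhys i.P i.k) i.U) (QlinK i.U i.k) (BIJ85Sect4Statements.aK a i.P.L i.k) (closedG a ha i φ) = φ :=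
  (Classical.choose_spec (exists_GK i.hk0 (cPhys_pos i.P i.k).ne' (i.aK_pos ha) i.U)).1 φ

/-- THE ACTUAL Sect. 7.3 DATUM of a closed-field index (as file B's `resStabData`: PRINTED `plaqDev p′ = |v(∂p′) − 1|`, first printed form,
THE inverse (4.6.2) at `u_k`, `ek = e_k`). [cite: BalabanImbrieJaffe1985, (7.3.2) p.326] -/
def closedStabData {d : ℕ} {KR pexp : ℝ} (a : ℝ) (ha : 0 < a) (i : ClosedIdx d KR pexp) : BIJ85Sect7Statements.ScalarStabData where
  Plaq := Balaban1983to89.Plaq i.P i.k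
  Bond := PBond i.P (0 + i.k)
  Site := Balaban1983to89.Site i.P (0 + i.k)
  Scalar := CoarseSpK i.P 0 i.k
  ek := i.e
  plaqDev := fun p => ‖((plaq i.v p : Circle) : ℂ) - 1‖
  covDiffSq := fun ψ b => ‖toC (lineIter i.U i.k b) * ψ b.tgt - ψ b.src‖ ^ 2
  absSq := fun ψ x => ‖ψ x‖ ^ 2
  deltaForm := fun ψ => ⟪ψ, deltaOp (QlinK i.U i.k) (BIJ85Sect4Statements.aK a i.P.L i.k) (closedG a ha i) ψ⟫

/-- **(7.3.1) ⇒ all oriented η-plaquette variables of the actual `u_k` are within `e_kη²K_R(π/2)𝓅(e_k)` of `1`** (closed-field form: `f^{(k)}`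
is closed by §1 since `e_k𝓅(e_k) ≤ ½`, so `hR` applies to it). [cite: BalabanImbrieJaffe1985, (7.3.1) p.326] -/
theorem theta_of_hyp731_closed {d : ℕ} {KR pexp : ℝ} (a : ℝ) (ha : 0 < a) (i : ClosedIdx d KR pexp)
    (h : (closedStabData a ha i).Hyp731 pexp) (x : Balaban1983to89.Site i.P 0) (μ ν : Fin i.P.d) :
    ‖plaqC i.U x μ ν - 1‖ ≤ i.e * (i.P.eta i.k) ^ 2 * (KR * (Real.pi / 2 * (1 + Real.log i.e⁻¹) ^ pexp)) := by
  set calP : ℝ := (1 + Real.log i.e⁻¹) ^ pexp with hcalP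
  have hcalP0 : 0 ≤ calP := by
    have hb : 0 ≤ 1 + Real.log i.e⁻¹ := by
      have := Real.log_nonneg ((one_le_inv₀ i.he).2 i.he1); linarith
    exact Real.rpow_nonneg hb _
  have hv : ∀ q, ‖((plaq i.v q : Circle) : ℂ) - 1‖ ≤ i.e * calP := fun q => h q
  have hf : ∀ q, |plaqField i.e i.v q| ≤ Real.pi / 2 * calP := by
    intro q
    calc |plaqField i.e i.v q| ≤ Real.pi / 2 * ‖((plaq i.v q : Circle) : ℂ) - 1‖ / i.e := abs_plaqField_le_of_dev i.he i.v q
      _ ≤ Real.pi / 2 * (i.e * calP) / i.e := by gcongr; exact i.he.le; exact hv q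
      _ = Real.pi / 2 * calP := by rw [mul_div_assoc, mul_div_cancel_left₀ _ i.he.ne']
  have hclosed := fun x μ ν lam hμν hνl => dPlaq_plaqField_eq_zero i.he i.v i.hsmall hv x (μ := μ) (ν := ν) (lam := lam) hμν hνl
  have hres := i.hR (plaqField i.e i.v) hclosed (Real.pi / 2 * calP) hf
  have hS : 0 ≤ KR * Real.sqrt ((i.P.eta i.k) ^ i.P.d) * (Real.pi / 2 * calP) := by
    have := i.KR_nonneg; positivity
  have hmain := norm_plaqC_actualBgU1_sub_one_le i.hd2 i.hk i.he.ne' i.v hS hres x μ ν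
  have hs : Real.sqrt ((i.P.eta i.k) ^ i.P.d) ≠ 0 := (Real.sqrt_pos.2 (pow_pos (eta_pos i.P i.k) _)).ne'
  rw [abs_of_pos i.he] at hmain
  refine hmain.trans (le_of_eq ?_)
  show _ = i.e * i.P.eta i.k ^ 2 * (KR * (Real.pi / 2 * calP))
  field_simp

/-- **`Ineq732 (min(a/(9(d+1)),1/12)) ½ ((4/3)d⁴((π/2)K_R)²(1+4𝓅₊)^{2𝓅₊})` AT EVERY CLOSED-FIELD INDEX under `Hyp731 𝓅`** (as file B's
`ineq732_resStabData`, the residual property being used on the closed field `f^{(k)}` only). [cite: BalabanImbrieJaffe1985, (7.3.2) p.326] -/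
theorem ineq732_closedStabData {d : ℕ} {KR pexp : ℝ} (a : ℝ) (ha : 0 < a) (i : ClosedIdx d KR pexp)
    (h : (closedStabData a ha i).Hyp731 pexp) :
    (closedStabData a ha i).Ineq732 (min (a / (9 * (d + 1))) (1 / 12)) (1 / 2)
      (4 / 3 * (d : ℝ) ^ 4 * (Real.pi / 2 * KR) ^ 2 * (1 + 4 * max pexp 0) ^ (2 * max pexp 0)) := by
  intro ψ
  change CoarseSpK i.P 0 i.k at ψ
  have hd' : (i.P.d : ℝ) = d := by rw [i.hd]
  have hθ := theta_of_hyp731_closed a ha i h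
  have hmain := ineq732_general_phys (j := 0) i.hk1 i.hk0 ha i.U hθ (closedG_spec a ha i) ψ
  have es : ((i.P.L : ℝ) ^ i.k) ^ 2 * (i.e * (i.P.eta i.k) ^ 2 * (KR * (Real.pi / 2 * (1 + Real.log i.e⁻¹) ^ pexp)))
      = Real.pi / 2 * KR * (i.e * (1 + Real.log i.e⁻¹) ^ pexp) := by
    have h1 := pow_mul_eta_sq i.P i.k
    calc ((i.P.L : ℝ) ^ i.k) ^ 2 * (i.e * (i.P.eta i.k) ^ 2 * (KR * (Real.pi / 2 * (1 + Real.log i.e⁻¹) ^ pexp)))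
        = (((i.P.L : ℝ) ^ i.k) ^ 2 * (i.P.eta i.k) ^ 2) * (Real.pi / 2 * KR * (i.e * (1 + Real.log i.e⁻¹) ^ pexp)) := by ring
      _ = _ := by rw [h1, one_mul]
  rw [es, hd', ← sum_norm_sq_eq ψ, mul_pow] at hmain
  have hS : 0 ≤ ∑ x : Balaban1983to89.Site i.P (0 + i.k), ‖ψ x‖ ^ 2 := sum_nonneg fun _ _ => by positivity
  have hd4 : (0 : ℝ) ≤ 4 / 3 * (d : ℝ) ^ 4 * (Real.pi / 2 * KR) ^ 2 := by positivity
  have hcmp := mul_le_mul_of_nonneg_right (mul_le_mul_of_nonneg_left (sq_hyp731_le pexp i.he i.he1) hd4) hS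
  show min (a / (9 * (d + 1))) (1 / 12) * bondForm (lineIter i.U i.k) ψ
      - 4 / 3 * (d : ℝ) ^ 4 * (Real.pi / 2 * KR) ^ 2 * (1 + 4 * max pexp 0) ^ (2 * max pexp 0) * i.e ^ (2 - 1 / 2 : ℝ)
          * ∑ x : Balaban1983to89.Site i.P (0 + i.k), ‖ψ x‖ ^ 2
      ≤ ⟪ψ, deltaOp (QlinK i.U i.k) (BIJ85Sect4Statements.aK a i.P.L i.k) (closedG a ha i) ψ⟫
  nlinarith [hmain, hcmp]

/-- **r15's `Claim73 𝓅` PROVED FOR THE FAMILY OF ACTUAL Sect. 7.3 DATA over `ClosedIdx d K_R 𝓅`** — every torus of dimension `d ≥ 2`, every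
`1 ≤ k ≤ m + K`, every `0 < e_k ≤ 1` with `e_k𝓅(e_k) ≤ ½`, EVERY unit-lattice `U(1)` field `v`; background (4.5.4) computed from `v` with the
operators of record; hypothesis = the printed (7.3.1) on `v`; located input = the residual property ON CLOSED FIELDS (the k-uniform form,
regularity of the minimizers).  Constants `γ = min(a/(9(d+1)), 1/12)`, `α = ½`, `M = (4/3)d⁴((π/2)K_R)²(1+4𝓅₊)^{2𝓅₊}`.
[cite: BalabanImbrieJaffe1985, (7.3.1)–(7.3.2) p.326] -/
theorem claim73_closed {d : ℕ} (a : ℝ) (ha : 0 < a) (KR pexp : ℝ) :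
    BIJ85Sect7Statements.ScalarStabData.Claim73 pexp (closedStabData (d := d) (KR := KR) (pexp := pexp) a ha) :=
  ⟨min (a / (9 * (d + 1))) (1 / 12), 1 / 2,
    4 / 3 * (d : ℝ) ^ 4 * (Real.pi / 2 * KR) ^ 2 * (1 + 4 * max pexp 0) ^ (2 * max pexp 0),
    lt_min (by positivity) (by norm_num), by norm_num, fun i hi => ineq732_closedStabData a ha i hi⟩

/-- **file B's all-field index is a closed-field index** (in the regime `e_k𝓅(e_k) ≤ ½`): the all-field residual property implies the
closed-field one — so file C's hypothesis-free `k = 1` constant `K₁(d, L)` also serves here. [cite: BalabanImbrieJaffe1985, (7.3.1) p.326] -/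
def ResIdx.toClosedIdx {d : ℕ} {KR pexp : ℝ} (i : ResIdx d KR) (hsmall : i.e * (1 + Real.log i.e⁻¹) ^ pexp ≤ 1 / 2) :
    ClosedIdx d KR pexp where
  P := i.P
  hd := i.hd
  hd2 := i.hd2
  k := i.k
  hk1 := i.hk1
  hk := i.hk
  e := i.e
  he := i.he
  he1 := i.he1
  hsmall := hsmall
  v := i.v
  hR := fun g _ C hg p => i.hR g C hg p

end

end Literature.MathematicalPhysics.QuantumFieldTheory.BalabanImbrieJaffe1984to88.BIJ85Claim73Closed
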